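import Literature.IUT.LogVolume.NormalizedHaar
import Mathlib.Analysis.SpecialFunctions.Log.Basic
import HarnessLib

/-!
# Log-volume and normalised (weighted) log-volume relative to an integral structure

Over `NormalizedHaar.lean` (the Haar measure `Λ.haar` with `Λ.haar Λ = 1` of a compact open subgroup
`Λ` of a locally compact abelian group `V`), this file defines and develops:

* `Λ.logVolume A = log (Λ.haar A)` — [AbsTopIII] Prop. 5.7 (i)(a): "we shall write
  `μ^log_k(−) := log(μ_k(−))` [where log denotes the natural logarithm `ℝ_{>0} → ℝ`] and refer to
  `μ^log_k(−)` as the log-volume on `k`";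
* `Λ.normalizedLogVolume d A = log (Λ.haar A) / d` — [IUTchIV] Prop. 1.4 (i): "The log-volumes … on
  the various finite extensions of `ℚ_p` … may be suitably normalized [i.e., by dividing by the degree
  of the finite extension] so as to yield a notion of log-volume `μ^log(−)` defined on compact open
  subsets …, valued in `ℝ`, and normalized so that `μ^log(R_i) = 0`, `μ^log(p·R_i) = −log(p)`";
  Dupuy–Hilado §3.4 "`log μ̄_W(Ω) := log μ_W(Ω)/dim_{ℚ_p} W`". The weight `d` is a parameter;
* `Λ.logVolume Λ = 0`, translation invariance, monotonicity, `μ^log(H) = −log [Λ : H]` for open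
  subgroups, the scaling rule `μ^log(φ(A)) = μ^log(A) + μ^log(φ(Λ))` ([AbsTopIII] 5.7 (i)(b)
  "`μ^log_k(x·A) = μ^log_k(A) + μ̇^log_k(x)`; in particular, if `x ∈ O_k^×`, then `μ^log_k(x·A) =
  μ^log_k(A)`"), `= μ^log(A) − log [Λ : φ(Λ)]` when `φ(Λ) ⊆ Λ`, and the prime-power-index form
  `μ^log_d(H) = −n·log b` when `[Λ : H] = b^{n·d}` (the shape of "`μ^log(p·R_i) = −log(p)`").

Log-volumes are meaningful on sets of positive finite volume (nonempty compact opens); elsewhere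
`Real.log 0 = 0` is a junk value, as documented on `logVolume`.
[cite: MochizukiAbsTopIII2015, Prop. 5.7 (i) pp. 137–138] [cite: Mochizuki2012, IUTchIV Prop. 1.4 (i) p. 13]
Deliberately NOT here: any IUT-specific object, any judgement on [IUTchIII] Cor. 3.12.
-/

noncomputable section

open MeasureTheory MeasureTheory.Measure Set TopologicalSpace
open scoped ENNReal NNReal Pointwise

namespace Literature.IUT.LogVolume

namespace IntegralStructure

variable {V : Type*} [AddCommGroup V] [TopologicalSpace V] [IsTopologicalAddGroup V]
  [MeasurableSpace V] [BorelSpace V] (Λ : IntegralStructure V)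

/-! ### Log-volume ([AbsTopIII] Prop. 5.7 (i)(a)) and normalised log-volume ([IUTchIV] Prop. 1.4 (i)) -/

/-- **The log-volume** `μ^log_Λ(A) := log μ_Λ(A)` ("we shall write `μ^log_k(−) := log(μ_k(−))` … and
refer to `μ^log_k(−)` as the log-volume on `k`"). Meaningful on sets of positive finite volume (there
`Real.log` of `0`, used for null or infinite-volume sets, is the junk value `0`).
[cite: MochizukiAbsTopIII2015, Prop. 5.7 (i)(a) p. 137] -/
def logVolume (A : Set V) : ℝ := Real.log (Λ.haar A).toReal

/-- **The normalised log-volume** of weight `d`: `μ^log(A) := log μ_Λ(A) / d` — [IUTchIV] Prop. 1.4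
(i) "may be suitably normalized [i.e., by dividing by the degree of the finite extension] so as to
yield a notion of log-volume `μ^log(−)` defined on compact open subsets …, valued in `ℝ`, and
normalized so that `μ^log(R_i) = 0`"; Dupuy–Hilado's "normalized `p`-adic valuation"
`log μ̄_W(Ω) := log μ_W(Ω)/dim_{ℚ_p} W`. The weight is a parameter (the degree / dimension in the
applications); `d = 0` gives the junk value `0`.
[cite: Mochizuki2012, IUTchIV Prop. 1.4 (i) p. 13] -/
def normalizedLogVolume (d : ℕ) (A : Set V) : ℝ := Λ.logVolume A / d

/-- `μ^log_Λ(Λ) = 0`. [cite: MochizukiAbsTopIII2015, Prop. 5.7 (i)(a)(3) p. 137] -/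
@[simp] theorem logVolume_self : Λ.logVolume (Λ : Set V) = 0 := by
  simp [logVolume]

/-- `μ^log(Λ) = 0` for every weight ("normalized so that `μ^log(R_i) = 0`").
[cite: Mochizuki2012, IUTchIV Prop. 1.4 (i) p. 13] -/
@[simp] theorem normalizedLogVolume_self (d : ℕ) : Λ.normalizedLogVolume d (Λ : Set V) = 0 := by
  simp [normalizedLogVolume]

/-- Translation invariance of the log-volume. [cite: MochizukiAbsTopIII2015, Prop. 5.7 (i)(a)(2) p. 137] -/
@[simp] theorem logVolume_vadd (x : V) (A : Set V) : Λ.logVolume (x +ᵥ A) = Λ.logVolume A := by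
  simp [logVolume]

/-- Translation invariance of the normalised log-volume.
[cite: Mochizuki2012, IUTchIV Prop. 1.4 (i) p. 13] -/
@[simp] theorem normalizedLogVolume_vadd (d : ℕ) (x : V) (A : Set V) :
    Λ.normalizedLogVolume d (x +ᵥ A) = Λ.normalizedLogVolume d A := by
  simp [normalizedLogVolume]

/-- Monotonicity: `A ⊆ B`, `μ_Λ(A) > 0`, `μ_Λ(B) < ∞` ⟹ `μ^log_Λ(A) ≤ μ^log_Λ(B)`.
[cite: MochizukiAbsTopIII2015, Prop. 5.7 (i)(a) p. 137] -/
theorem logVolume_mono {A B : Set V} (hA : 0 < Λ.haar A) (hB : Λ.haar B < ∞) (h : A ⊆ B) :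
    Λ.logVolume A ≤ Λ.logVolume B := by
  unfold logVolume
  have hA' : Λ.haar A < ∞ := lt_of_le_of_lt (measure_mono h) hB
  exact Real.log_le_log (ENNReal.toReal_pos hA.ne' hA'.ne)
    (ENNReal.toReal_mono hB.ne (measure_mono h))

/-- Monotonicity of the normalised log-volume. [cite: Mochizuki2012, IUTchIV Prop. 1.4 (i) p. 13] -/
theorem normalizedLogVolume_mono (d : ℕ) {A B : Set V} (hA : 0 < Λ.haar A) (hB : Λ.haar B < ∞)
    (h : A ⊆ B) : Λ.normalizedLogVolume d A ≤ Λ.normalizedLogVolume d B :=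
  div_le_div_of_nonneg_right (Λ.logVolume_mono hA hB h) (Nat.cast_nonneg d)

/-- Log-volume of an open subgroup `H ≤ Λ`: `μ^log_Λ(H) = −log [Λ : H]` (so `μ^log_k(m_k^n) =
−n·log q = −f·n·log p`). [cite: MochizukiAbsTopIII2015, Prop. 5.7 (i)(a) p. 137] -/
theorem logVolume_coe_openAddSubgroup (H : OpenAddSubgroup V)
    (hH : (H : AddSubgroup V) ≤ (Λ.toOpenAddSubgroup : AddSubgroup V)) :
    Λ.logVolume (H : Set V) =
      -Real.log ((H : AddSubgroup V).relIndex (Λ.toOpenAddSubgroup : AddSubgroup V)) := by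
  rw [logVolume, Λ.haar_coe_eq_inv_relIndex H hH, ENNReal.toReal_inv, Real.log_inv]
  simp

/-- **Log-volume scaling** ([AbsTopIII] Prop. 5.7 (i)(b) "`μ^log_k(x·A) = μ^log_k(A) + μ̇^log_k(x)`",
abstractly): for a set `A` of positive finite volume and a continuous additive automorphism `φ`,
`μ^log_Λ(φ(A)) = μ^log_Λ(A) + μ^log_Λ(φ(Λ))`. [cite: MochizukiAbsTopIII2015, Prop. 5.7 (i)(b) p. 138] -/
theorem logVolume_image (φ : V ≃ₜ+ V) {A : Set V} (hA : 0 < Λ.haar A) (hA' : Λ.haar A < ∞) :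
    Λ.logVolume (φ '' A) = Λ.logVolume A + Λ.logVolume (φ '' (Λ : Set V)) := by
  unfold logVolume
  rw [Λ.haar_image φ A, ENNReal.toReal_mul, Real.log_mul
    (ENNReal.toReal_pos (Λ.haar_image_self_pos φ).ne' (Λ.haar_image_self_lt_top φ).ne).ne'
    (ENNReal.toReal_pos hA.ne' hA'.ne).ne', add_comm]

/-- Normalised version of the scaling rule ("action through a factor": `μ^log(φ(A)) = μ^log(A) +
μ^log(φ(Λ))`). [cite: Mochizuki2012, IUTchIV Prop. 1.4 (i) p. 13] -/
theorem normalizedLogVolume_image (d : ℕ) (φ : V ≃ₜ+ V) {A : Set V} (hA : 0 < Λ.haar A)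
    (hA' : Λ.haar A < ∞) :
    Λ.normalizedLogVolume d (φ '' A) =
      Λ.normalizedLogVolume d A + Λ.normalizedLogVolume d (φ '' (Λ : Set V)) := by
  simp only [normalizedLogVolume, Λ.logVolume_image φ hA hA', add_div]

/-- Log form: `μ^log_Λ(φ(A)) = μ^log_Λ(A)` when `φ(Λ) = Λ`.
[cite: MochizukiAbsTopIII2015, Prop. 5.7 (i)(b) p. 138] -/
theorem logVolume_image_of_image_eq (φ : V ≃ₜ+ V) (hφ : φ '' (Λ : Set V) = (Λ : Set V))
    (A : Set V) : Λ.logVolume (φ '' A) = Λ.logVolume A := by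
  simp [logVolume, Λ.haar_image_of_image_eq φ hφ]

/-- Log-volumes for two integral structures differ by the constant `μ^log_Λ(Λ')`:
`μ^log_{Λ'}(A) = μ^log_Λ(A) − μ^log_Λ(Λ')` (on sets of positive finite volume).
[cite: MochizukiAbsTopIII2015, Prop. 5.7 (i)(a) p. 137] -/
theorem logVolume_eq_logVolume_sub (Λ' : IntegralStructure V) {A : Set V} (hA : 0 < Λ.haar A)
    (hA' : Λ.haar A < ∞) : Λ'.logVolume A = Λ.logVolume A - Λ.logVolume (Λ' : Set V) := by
  have h0 : Λ.haar (Λ' : Set V) ≠ 0 := (Λ.haar_pos_of_isOpen Λ'.isOpen Λ'.nonempty).ne'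
  have ht : Λ.haar (Λ' : Set V) ≠ ∞ := (Λ.haar_lt_top_of_isCompact Λ'.isCompact).ne
  unfold logVolume
  rw [Λ.haar_eq_smul_haar Λ', Measure.smul_apply, smul_eq_mul, ENNReal.toReal_mul,
    ENNReal.toReal_inv, Real.log_mul (inv_ne_zero (ENNReal.toReal_pos h0 ht).ne')
      (ENNReal.toReal_pos hA.ne' hA'.ne).ne', Real.log_inv]
  ring

/-- Log form: if `φ(Λ) ⊆ Λ` then `μ^log_Λ(φ(A)) = μ^log_Λ(A) − log [Λ : φ(Λ)]` for `A` of positive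
finite volume. [cite: MochizukiAbsTopIII2015, Prop. 5.7 (i)(b) p. 138] -/
theorem logVolume_image_of_mapsTo (φ : V ≃ₜ+ V) (hφ : MapsTo φ (Λ : Set V) (Λ : Set V))
    {A : Set V} (hA : 0 < Λ.haar A) (hA' : Λ.haar A < ∞) :
    Λ.logVolume (φ '' A) = Λ.logVolume A -
      Real.log ((Λ.imageOpenAddSubgroup φ : AddSubgroup V).relIndex
        (Λ.toOpenAddSubgroup : AddSubgroup V)) := by
  rw [Λ.logVolume_image φ hA hA']
  unfold logVolume
  rw [Λ.haar_image_self_eq_inv_relIndex φ hφ, ENNReal.toReal_inv, Real.log_inv]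
  simp only [ENNReal.toReal_natCast]
  ring

/-- **Normalised log-volume of a sublattice of prime-power index**: if `[Λ : H] = b^(n·d)` then the
weight-`d` log-volume of `H` is `−n·log b` — the shape of "[normalized so that] `μ^log(p·R_i) =
−log(p)`" (`[R_i : p·R_i] = p^{[k_i:ℚ_p]}`). [cite: Mochizuki2012, IUTchIV Prop. 1.4 (i) p. 13] -/
theorem normalizedLogVolume_coe_openAddSubgroup_of_relIndex_eq_pow (H : OpenAddSubgroup V)
    (hH : (H : AddSubgroup V) ≤ (Λ.toOpenAddSubgroup : AddSubgroup V)) {b n d : ℕ} (hd : 0 < d)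
    (hidx : (H : AddSubgroup V).relIndex (Λ.toOpenAddSubgroup : AddSubgroup V) = b ^ (n * d)) :
    Λ.normalizedLogVolume d (H : Set V) = -(n * Real.log b) := by
  rw [normalizedLogVolume, Λ.logVolume_coe_openAddSubgroup H hH, hidx]
  push_cast
  rw [Real.log_pow]
  have hd' : (d : ℝ) ≠ 0 := by exact_mod_cast hd.ne'
  field_simp
  push_cast
  ring

/-- Monotonicity of the log-volume on nonempty compact open sets.
[cite: MochizukiAbsTopIII2015, Prop. 5.7 (i)(a) p. 137] -/
theorem logVolume_mono_compactOpens {A B : CompactOpens V} (hne : (A : Set V).Nonempty)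
    (h : (A : Set V) ⊆ B) : Λ.logVolume A ≤ Λ.logVolume B :=
  Λ.logVolume_mono (Λ.haar_compactOpens_pos A hne) (Λ.haar_compactOpens_lt_top B) h

end IntegralStructure

end Literature.IUT.LogVolume
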